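import Mathlib
import HarnessLib
import HarnessLib.Audit
import Summits.NavierStokesRegularity.Statement
import Literature.Analysis.FluidPDE.ClassicalSolution
import Literature.Analysis.FluidPDE.LerayHopf
import Literature.Analysis.FluidPDE.SelfSimilarLiouville
import Literature.Analysis.FluidPDE.SuitableWeak
import Literature.Analysis.FluidPDE.NSWave0
import Literature.Analysis.FluidPDE.HyperbolicDSSOrbit
import Summits.NavierStokesRegularity.NavierStokesRegularity.Theses.Blowup
import Summits.NavierStokesRegularity.NavierStokesRegularity.Theorems.BlowupBlowupClayNonuniquenessRefutation
import Summits.NavierStokesRegularity.NavierStokesRegularity.Theorems.AdiabaticEddyClayUniqueness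
import HarnessLib.Audit.Status.Attr

/-!
Route: DssFarFieldSlaving

# Route DssFarFieldSlaving — NavierStokesRegularity, NEGATIVE side; CONDITIONAL BRIDGE
(load-bearing: existence of a Type-I (rotated) λ-DSS ancient profile =
¬Literature.Analysis.FluidPDE.TypeIDSSLiouvilleConjecture = route Blowup's crux #5
`Blowup.BlowupTypeIDssProfile` = the SHARED ledger item stmt-NavierStokesRegularity-0155, which
since route-choice (a) of 2026-08-16 is this route's own crux #5 `BlowupTypeIDssProfile` — same
statement verbatim (gen 3: the by-name alias stmt-14193 of gen 0 was restated to the statement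
itself, so the two routes want ONE item), and the hypothesis hP of the crux-only deciding theorem)
Card realised: NavierStokesRegularity/NavierStokesRegularity/dss-far-field-slaving. Decomposes the
half of route Blowup's crux #5 that Blowup leaves "NOT decomposed" (truncation of an infinite-energy
DSS profile to a Schwartz datum keeping the singularity).

## Thesis X = B ∧ H1 ("it suffices to show")
B (TRUNCATION BRIDGE): if some nontrivial ancient mild solution on ℝ³×(−∞,0) is (rotated) λ-DSS with
the Type-I bound |u| ≤ C₀/(|x|+√−t) — i.e. if Tsai's Type-I DSS Liouville conjecture FAILS — then
there is ν>0 and a classical NS solution on ℝ³×[0,T), Leray–Hopf from a rapidly decaying datum, with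
NO smooth extension past T (X5a of route Blowup, verbatim shape).
H1 (PROFILE): Tsai's Type-I (rotated) λ-DSS Liouville conjecture FAILS = this route's crux
BlowupTypeIDssProfile = the shared item stmt-0155 = route Blowup's crux #5 (one ledger item, two
routes; `Iff.rfl` with ¬TypeIDSSLiouvilleConjecture).
Lean (elaborates; rev 6 states everything with the conjecture UNFOLDED one level, so no
@[conjecture]-tagged constant sits in the route cone):
 B: ¬ (∀ c, TypeIDSSLiouville c ∧ ∀ R, RotatedTypeIDSSLiouville c R) → ∃ ν>0, ∃ T>0, ∃ u p,
IsMaximalSmoothSolution ν 0 u p T ∧ IsLerayHopfOn T ν 0 (u 0) u ∧ HasRapidSpatialDecay (u 0)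
 H1: BlowupTypeIDssProfile := ¬ (∀ c, TypeIDSSLiouville c ∧ ∀ R, RotatedTypeIDSSLiouville c R)
(verbatim stmt-0155 = Blowup.BlowupTypeIDssProfile, `Iff.rfl`)

## Assembly X → ¬NavierStokesRegularity
B → H1 → ¬NavierStokesRegularity: this IS the route's deciding theorem, CRUX-ONLY since gen 3 —
`closes (hB : DssTruncationBridge) (hP : BlowupTypeIDssProfile) : ¬NavierStokesRegularity`, PROVED
in the route file (axioms propext/Classical.choice/Quot.sound). X5b (Clay-class uniqueness, support
item ClayUniqueness = stmt-NavierStokesRegularity-0153, shared) is no longer a hypothesis: it is a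
THEOREM in tree — ¬¬X5b = `Theorems.BlowupBlowupClayNonuniqueness_refuted` (landed 2026-08-15,
Tao2011 Cor. 11.4 via `tao_unconditional_uniqueness_velocity_holds`) — and is discharged inside the
proof by `Classical.not_not.mp`; the rest is pure logic (Clay (A) on the datum u 0, X5b gluing on
[0,T), restriction to [0,T+1) vs maximality). The items `Assembly` (B → H1 → X5b → ¬NS as a Prop),
`ThesisOfCruxes : B → H1 → Thesis` and `ClayUniqueness` itself are provable now (candidate proofs
attached / the one-liner above).

## Why the bridge should hold: the far field is SLAVED
In backward similarity variables (y = x/√(T−t), s = −log(T−t), U = √(T−t)·u) a λ-DSS solution is an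
s-PERIODIC ORBIT U_* of ∂_sU = 𝓛U − U·∇U − ∇P with 𝓛 = νΔ − ½y·∇ − ½, self-adjoint with compact
resolvent and spectrum {−½ − k/2} on the Gaussian space L²(e^{−|y|²/4ν}): a GAP of ½. The Type-I
decay |U_*(y)| ≤ C/(1+|y|) is exactly what makes U_*·∇ an 𝓛-bounded perturbation there
(|∫|w|²(U_*·y)γ| ≤ (C/4ν)‖w‖²), so Floquet theory is meaningful; truncating u_* at radius R
(Bogovskiĭ-corrected, mollified tail) changes the datum by O(e^{−R²/8ν}) in the Gaussian space
although by O(1/R) in L^∞ — the weight is blind to the far field, which never reaches the core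
(outward characteristic drift ½y; far-field pressure influence ≲ C²/L², L = Re^{s/2}, summable in
s). A finite-codimension stable-manifold theorem for the periodic orbit (Henry's framework;
prescribed-profile template of semilinear heat: Herrero–Velázquez, Bricmont–Kupiainen, Merle–Zaag,
Collot–Raphaël–Szeftel) then tunes finitely many compactly supported core bumps so that the rescaled
solution converges to U_* — blow-up at (x₀,T) at Type-I rate from a Schwartz datum. Forward twin
(theorem): Jia–Šverák's spectral programme and Bradshaw–Tsai/Chae–Wolf "DSS + L² perturbation ⇒
global, asymptotically DSS".

## Two-layer plan (D-0019)
Layer 1 (cruxes): B (rank 2, typed, UNCONDITIONAL in the hyperbolicity — the strong form);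
HyperbolicDssBridge (rank 3, informal until the notion IsHyperbolicTypeIDSSOrbit is defined: (H1) ∧
(H2: finitely many Floquet multipliers outside the closed unit disc, neutral ones = symmetry modes)
⇒ X5a — the honest conditional form); GaussianFloquetTheory (rank 4, informal: the linearisation
about a Type-I DSS orbit generates an evolution family with compact resolvent on the
Gaussian-weighted divergence-free space, vorticity formulation); H1 (rank 5: BlowupTypeIDssProfile =
stmt-0155, shared with Blowup #5 — staffed once for both routes; profile-hunter cards). Layer 2
(later, glued split of HyperbolicDssBridge): (B2) far-field/core decoupling bootstrap in (L²(γ),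
L^∞_{1+|y|}); (B3) stable manifold with symmetry-induced neutral directions (modulation in x₀, T;
rotations); (B4) Schwartz realisation of the tuned datum.

CONDITIONAL on Summit.NavierStokesRegularity.NavierStokesRegularity.Theses.Blowup.BlowupTypeIDssProfile — this route is an explicit reduction to that named conjecture (D-0019: crux floor waived).

Rationale: WHY THIS LINE. Route Blowup (rev 3) files the analytic profile half of a DSS blow-up as crux #5
(BlowupTypeIDssProfile = ¬TypeIDSSLiouvilleConjecture, Tsai2018 Conj. 8.8–8.9 negated; forward
existence for every λ: BradshawTsai2017CPDE, ChaeWolf2017) and leaves the other half — "truncation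
to a Schwartz datum keeping the singularity (stable manifold / gluing)" — explicitly NOT decomposed.
This route IS that half, stated as a bridge B with its enabling estimate: Type-I decay |y||U_*(y)| ≤
C ⇔ 𝓛-boundedness of the transport term in the Gaussian space L²(e^{−|y|²/4ν}) of the Leray
similarity variables, where 𝓛 = νΔ − ½y·∇ − ½ has compact resolvent and gap ½; the infinite energy
of the profile (|u_*| ~ C/|x| ∉ L²) is invisible to the weight, and the far field is slaved (outward
drift, CZ decay of far-field pressure). Imported areas: invariant-manifold theory for time-periodic
semilinear parabolic equations (Henry 1981; Floquet theory in weighted L²), the prescribed-profile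
blow-up constructions of semilinear heat (Herrero–Velázquez 1992–94, Bricmont–Kupiainen 1994,
Merle–Zaag 1997, Collot–Raphaël–Szeftel 2019), Gaussian-weighted spectral theory of the 2-D
vorticity equation (Gallay–Wayne 2005) as the functional template; forward NS twins
JiaSverak2014/JiaSverak2015 (spectral hypothesis at a scale-invariant infinite-energy object ⇒
finite-energy Leray–Hopf consequence) and BradshawTsai2019/ChaeWolf2017 (DSS + perturbation). The
route converts Tsai's conjecture from a Liouville curiosity into a dichotomy for the summit:
TypeIDSSLiouvilleConjecture (all λ, R) OR — given hyperbolicity — ¬Clay (A); and it tells refuters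
of the positive routes exactly which object to exhibit.
RANKED CRUXES. #2 DssTruncationBridge B (typed; strong form, no hyperbolicity assumed — why it might
fail: a DSS orbit could carry infinitely many unstable Floquet multipliers accumulating at the unit
circle if the sup-norm half of the far-field bootstrap creates essential spectrum; then only the
conditional form survives). #3 HyperbolicDssBridge (informal until `IsHyperbolicTypeIDSSOrbit` is
defined; definition request filed): (H1) ∧ (H2) ⇒ X5a — the card's CLAIM. #4 GaussianFloquetTheory
(informal): (B1) of the card — the linearised operator A(s)w = 𝓛w − P_σ(U_*·∇w + w·∇U_*) generates
an evolution family with compact resolvent on the Gaussian-weighted divergence-free space (the Leray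
projection is NOT bounded on L²(γ) verbatim: vorticity formulation / Gallay–Wayne weighted Helmholtz
decomposition), so that (H2) is meaningful; cheapest test: carry it out for an explicit
Type-I-decaying steady model field (two pages). #5 BlowupTypeIDssProfile H1 (= the SHARED item
stmt-0155 = route Blowup's crux #5 `Blowup.BlowupTypeIDssProfile`, the declared conditional_on, same
statement verbatim; gen 3 restated gen 0's by-name alias stmt-14193 to the statement so that ONE
item serves both routes, a proof or refutation propagates to both by name, and the item survives a
closure of Blowup; why it might fail: the Liouville side may simply hold — λ near 1 removed under
exactly this bound, ChaeWolf2017RemovingDSS Thm 1.3; λ-continuous profiles vanish,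
NecasRuzickaSverak1996, Tsai1998; axisymmetric Type I regular, SereginSverak2009). Support:
ClayUniqueness (= stmt-0153, shared; PROVED in tree as ¬¬X5b =
Theorems.BlowupBlowupClayNonuniqueness_refuted, hence discharged INSIDE `closes` and no longer one
of its hypotheses — the deciding theorem is crux-only: closes (hB : DssTruncationBridge) (hP :
BlowupTypeIDssProfile)), ThesisOfCruxes (B → H1 → Thesis, one line), DssTruncationBridgeTypeI (B
with the Type-I rate in the conclusion: what the stable manifold actually yields; it also produces a
Type-I singular point, hence ¬(L) via AlbrittonBarker2019 — informative for route TypeILiouville).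
KILL CRITERIA. TypeIDSSLiouvilleConjecture proved (H1 = stmt-0155 refuted by name ⇒ this route and
Blowup flip BROKEN together, no transfer needed) ⇒ close `refuted:BlowupTypeIDssProfile` (the bridge
B survives as a vacuous-hypothesis curiosity; record and close). B refuted (a nontrivial Type-I DSS
profile whose every Schwartz truncation is global) would be a spectacular positive-side structure
theorem — pivot to the conditional form #3. GaussianFloquetTheory failing on the model field
(essential spectrum from the far field even in vorticity form) ⇒ restate #3/#4 in a
weighted-sup/Hölder framework or close `exhausted`. NoBlowup (stmt-0054) proved ⇒ moot.
NOT DECOMPOSED YET. (B2) far-field/core decoupling, (B3) modulation/stable manifold with neutral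
symmetry directions, (B4) Schwartz realisation — layer-2 children of #3, filed only after #4 is
settled on a model; the SOURCE of H1 (O_h relay, quarter-turn RDSS, dynamo fixed point,
harmonic-balance search — other cards) is deliberately outside this route; X5b is settled (proved in
tree 2026-08-15; item 0153 closes when a prover re-lands the one-liner), nothing to attack.
CHEAPEST FALSIFIER. GaussianFloquetTheory (#4) carried out for one explicit Type-I-decaying steady
model field U(y) with |y||U(y)| ≤ C₀ (two pages): if the far field produces essential spectrum of
the monodromy on L²(e^{−|y|²/4ν}) even in vorticity form, (H2) is meaningless as stated and #2/#3
must be re-framed (weighted-sup/Hölder) or the route closed `exhausted`; on the premise side, a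
proof of Tsai's conjecture for all λ>1 under the Type-I bound (extending ChaeWolf2017RemovingDSS Thm
1.3 beyond λ≈1) kills H1.
NUMBERS. 𝓛-spectrum {−½ − k/2}, gap ½; 𝓛-boundedness constant C/(4ν) with C the Type-I constant;
trivial Floquet multipliers: e^{P} (time shift), e^{P/2} ×3 (translations, unstable, absorbed by
x₀), 1 ×3 (rotations, neutral), 1 (orbit tangent); truncation error e^{−R²/(8ν)} in L²(γ) vs C/R in
L^∞; far-field pressure influence at the core ≲ C²/L², L = R e^{s/2}. Items at open: 6 typed (2
cruxes + 2 support + target + assembly) + 2 informal cruxes added after open = 8; rev 6–8: 10 decls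
(target Thesis, Assembly, cruxes #2 DssTruncationBridge / #3 HyperbolicDssBridge / #4
GaussianFloquetTheory / #5 BlowupTypeIDssProfile (= shared stmt-0155 since gen 3),
DssTruncationBridgeTypeI, support ClayUniqueness + ThesisOfCruxes) + the crux-only deciding theorem
closes (2 hypotheses).

Novelty: NOVELTY (searched 2026-08-15: `lit frontier NavierStokesRegularity --since 2022` (forward
self-similar/DSS papers only: arXiv:2601.03161, arXiv:2603.12497, arXiv:2601.03833 — all FORWARD,
2-D or hypodissipative), `lit search --source arxiv "discretely self-similar blow-up Navier-Stokes
backward Type I construction"` (0), `lit search --source zbmath "self-similar singularity stable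
manifold weighted Gaussian Navier-Stokes blowup profile truncation"` (0), OpenAlex budget exhausted
(429); the card's own audit (refuter-novelty-audit-6, 2026-08-15): zbMATH DSS sweep, reads of
Pineau–Vicol arXiv:2607.09619 pp.5-6,31-35, in-tree docstrings of `chae_wolf_dss_existence` /
`TypeIDSSLiouvilleConjecture` (forward existence vs backward Liouville carefully separated; no
transfer statement); route Blowup rev 3 ("truncation … NOT decomposed").
Nearest prior art: JiaSverak2014 (Invent. 196) / JiaSverak2015 (JFA 268, arXiv:1306.2136) — the
FORWARD structural twin: a spectral hypothesis on the linearisation at a scale-invariant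
infinite-energy NS object in similarity variables ⇒ a finite-energy Leray–Hopf consequence via
truncation + local-in-space regularity (there: non-uniqueness; an INSTABILITY argument suffices);
BradshawTsai2017CPDE / BradshawTsai2019 / ChaeWolf2017 (forward DSS existence, DSS + L²
perturbation); semilinear-heat prescribed-profile constructions in L²_ρ (Herrero–Velázquez,
Bricmont–Kupiainen Nonlinearity 7 (1994), Merle–Zaag Duke 86 (1997), Collot–Raphaël–Szeftel Mem. AMS
2  [refs: 2601.03161, 2603.12497, 2601.03833, 2607.09619, 1306.2136, JiaSverak2014, JiaSverak2015, BradshawTsai2019, ChaeWolf2017]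

Barriers (technique_class: blowup-construction stable-manifold weighted-spectral): BARRIERS (catalogue Literature/Barriers/NavierStokesRegularity read; technique_class:
blowup-construction stable-manifold).
- Literature.Barriers.NavierStokesRegularity.LeraySelfSimilarBlowupExclusion (necas_ruzicka_sverak,
tsai_selfsimilar, tsai_selfsimilar_local_energy): applies to EXACTLY self-similar profiles (fixed
points of the similarity flow, λ-continuous); evaded as the entry records — the bridge is stated for
s-PERIODIC orbits (λ-DSS, λ > 1, and rotated DSS), outside the Chae–Wolf window λ ≈ 1
(ChaeWolf2017RemovingDSS Thm 1.3) which constrains H1, not B.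
- Literature.Barriers.NavierStokesRegularity.CriticalNormBlowupNecessity (ess_endpoint,
seregin_L3_blowup, tao_L3_blowup_rate): respected — the constructed solution's L³ norm diverges
(log-periodic × growing truncation radius in similarity variables; weak-L³ stays bounded), exactly
the Type-I signature the barrier leaves open; no L³-bounded ansatz is used.
- Literature.Barriers.NavierStokesRegularity.SingularSetDimensionBound (ckn_partial_regularity):
respected — one singular point (x₀, T).
- Literature.Barriers.NavierStokesRegularity.AxisymmetricTypeIExclusion (SereginSverak2009; in-tree
knss_no_axisymmetric_typeI): constrains H1 (the orbit cannot be axisymmetric), not the bridge B;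
recorded so that profile hunters use non-axisymmetric sectors (O_h relay, quarter-turn RDSS cards).
- Literature.Barriers.NavierStokesRegularity.TruncatedDyadicTypeIBlowup / TaoAveragedBlowup /
EnergySupercriticality: not engaged (const

Novelty grade: new-combination — ROUTE REVIEW gen-1 (refuter f31d8029; after 853747fc + grounder g14-0): KEEP as conditional negative-side bridge; ONE PLANNER ACTION. Lean: 6 typed decls rc0; Assembly = blowup_assembly ⟨hB hP, hU⟩ proved (evidence 0900); 0902→0901 proved; 0155 ↔ Blowup #5 rfl; Conj → B proved (B ⇔ Conj ∨ X5a: vacuo (refuter refuter-rreview-route-NavierStokesRegula-f31d8029-0, 2026-08-15T14:11:56Z; prior: arXiv:1811.00502 AlbrittonBarker2019 Thm 1.1/Rem 4.3, JiaSverak2014 Invent. 196, arXiv:1306.2136 JiaSverak2015, arXiv:1610.09464 ChaeWolf2017, arXiv:1610.05680 BradshawTsai2017 OP 5.1, Tsai2018 GSM192 Conj 8.8-8.9, Henry1981 LNM840 Ch.7-8, GallayWayne2005 CMP 255)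

History (route lifecycle, newest last):
- 2026-08-16T02:17:27Z · AUTO-CRUX: 3 conjecture-grade item(s) promoted to crux (Thesis, Assembly, DssTruncationBridgeTypeI) — refuter vetting / tiering apply (operator:999:1362873)
- 2026-08-16T03:13:49Z · rev 4: dropped TypeIDssProfileExists — route-choice (operator hold bridge-only 2026-08-16T02:41Z), option (a) ADD BlowupTypeIDssProfile AS A CRUX: the declared conditional_on premise Summit…Theses.Bl (planner-rchoice-NavierStokesRegularity-DssFarF-ae553558-0)
- 2026-08-16T03:28:35Z · rev 6: restated DssTruncationBridge (stmt-NavierStokesRegularity-0901), DssTruncationBridgeTypeI (stmt-NavierStokesRegularity-0902), Thesis (stmt-NavierStokesRegularity-0899), Assembly (stmt-NavierStokesRegularity-0900) — cone repair after route-choice (a) (rev 4/5): restate DssTruncationBridge, DssTruncationBridgeType (planner-rchoice-NavierStokesRegularity-DssFarF-ae553558-0)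
- 2026-08-16T04:18:08Z · rev 8: restated BlowupTypeIDssProfile (stmt-NavierStokesRegularity-14193) — route-choice gen 3 (unit rchoice-NavierStokesRegularity-DssFarF-ae553558-g3; operator hold bridge-only 2026-08-16T02:41Z), OPTION (a) add BlowupTypeIDssProfile (planner-rchoice-NavierStokesRegularity-DssFarF-ae553558-g3-0)
- 2026-08-23T13:29:31Z · DORMANT — reconciler: no traction for 6.1 d (last activity statement-closed at 2026-08-17T10:47:21Z); parked, not closed — `ledger route dormant route-NavierStokesRegular (operator:999:1775526)
- 2026-08-28T10:04:07Z · REACTIVATED — reconciler: reactivated — activity item-evidence-added at 2026-08-28T07:59:58Z after parking at 2026-08-23T13:29:31Z (operator:999:2441393)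

sub-problem: NavierStokesRegularity · status: open · opened planner-plancards-NavierStokesRegularity-NavierStokesRegularity-6c78a5c7d1-0 2026-08-15T10:34:12Z · rev 9 · ledger route-NavierStokesRegularity-DssFarFieldSlaving
GENERATED by the gate from the ledger (D-0016/17). Provers cite these decls: `theorem foo : Summit.NavierStokesRegularity.NavierStokesRegularity.Theses.DssFarFieldSlaving.<Decl> := …` in Summits/NavierStokesRegularity/NavierStokesRegularity/Theorems/<Name>.lean.
-/

namespace Summit.NavierStokesRegularity.NavierStokesRegularity.Theses.DssFarFieldSlaving

open scoped BigOperators Topology Manifold Classical MeasureTheory ProbabilityTheory Matrix InnerProductSpace ComplexConjugate ContinuousMap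
open Filter Set Function TopologicalSpace MeasureTheory

attribute [summit_statement] _root_.NavierStokesRegularity
-- H21.Audit: conditional_on 'Summit.NavierStokesRegularity.NavierStokesRegularity.Theses.Blowup.BlowupTypeIDssProfile' is not an accepted declaration — no route_premise tag

open Literature.NS

-- earlier Thesis (stmt-NavierStokesRegularity-0899, replaced 2026-08-16T03:28:35Z -> stmt-NavierStokesRegularity-14479): retired by None — (¬ Literature.Analysis.FluidPDE.TypeIDSSLiouvilleConjecture → ∃ ν : ℝ, 0 < ν ∧ ∃ T : ℝ, 0 < T ∧ ∃ (u : ℝ → EuclideanSpace ℝ (Fin 3) → EuclideanSpace ℝ (Fin 3)) (p : ℝ → EuclideanSpace ℝ (Fin 3) → ℝ), Literature.Analysis.FluidPDE.IsMaximalSmoothSolution ν 0 u p T 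
/-- item stmt-NavierStokesRegularity-14479 · target · rank 0 · open · by planner
why it might fail: H1 may be false (Tsai's conjecture: λ≈1 and small C₀ already removed under this bound, ChaeWolf2017RemovingDSS Thm 1.3/Rmk 1.4); B may hold only vacuously, or fail without hyperbolicity (no spectral gap for the monodromy of a large-C₀ Type-I orbit; nonlocal pressure vs Gaussian weight).
sources: Tsai2018, ChaeWolf2017RemovingDSS, JiaSverak2014, JiaSverak2015, BradshawTsai2017CPDE, arXiv:math/0102197
[target] X = B ∧ H1 — rev-6 RESTATEMENT with ¬TypeIDSSLiouvilleConjecture unfolded one level in both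
conjuncts (Iff.rfl; cone repair), otherwise verbatim: (B, DssTruncationBridge) failure of Tsai's
Type-I DSS Liouville conjecture ⇒ a finite-energy classical NS solution from a rapidly decaying
datum with finite maximal lifespan (X5a shape of route Blowup); (H1, BlowupTypeIDssProfile = route
Blowup #5, stmt-0155 verbatim) the conjecture fails. CONDITIONAL BRIDGE: H1 is load-bearing. Reached
from the cruxes by the support glue ThesisOfCruxes. Card: dss-far-field-slaving. -/
@[route_item "route-NavierStokesRegularity-DssFarFieldSlaving"]
def Thesis : Prop :=
  (¬ (∀ c : ℝ, Literature.Analysis.FluidPDE.TypeIDSSLiouville c ∧ ∀ R : EuclideanSpace ℝ (Fin 3) ≃ₗᵢ[ℝ] EuclideanSpace ℝ (Fin 3), Literature.Analysis.FluidPDE.RotatedTypeIDSSLiouville c R) → ∃ ν : ℝ, 0 < ν ∧ ∃ T : ℝ, 0 < T ∧ ∃ (u : ℝ → EuclideanSpace ℝ (Fin 3) → EuclideanSpace ℝ (Fin 3)) (p : ℝ → EuclideanSpace ℝ (Fin 3) → ℝ), Literature.Analysis.FluidPDE.IsMaximalSmoothSolution ν 0 u p T ∧ Literature.Analysis.FluidPDE.IsLerayHopfOn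 T ν 0 (u 0) u ∧ Literature.Analysis.FluidPDE.HasRapidSpatialDecay (u 0)) ∧ ¬ (∀ c : ℝ, Literature.Analysis.FluidPDE.TypeIDSSLiouville c ∧ ∀ R : EuclideanSpace ℝ (Fin 3) ≃ₗᵢ[ℝ] EuclideanSpace ℝ (Fin 3), Literature.Analysis.FluidPDE.RotatedTypeIDSSLiouville c R)

-- earlier DssTruncationBridge (stmt-NavierStokesRegularity-0901, replaced 2026-08-16T03:28:35Z -> stmt-NavierStokesRegularity-14477): retired by None — ¬ Literature.Analysis.FluidPDE.TypeIDSSLiouvilleConjecture → ∃ ν : ℝ, 0 < ν ∧ ∃ T : ℝ, 0 < T ∧ ∃ (u : ℝ → EuclideanSpace ℝ (Fin 3) → EuclideanSpace ℝ (Fin 3)) (p : ℝ → EuclideanSpace ℝ (Fin 3) → ℝ), Literature.Analysis.FluidPDE.IsMaximalSmoothSolutio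
/-- item stmt-NavierStokesRegularity-14477 · crux · rank 2 · closed · proved by Summit.NavierStokesRegularity.NavierStokesRegularity.Theorems.dssTruncationBridge_proof @ f18bb75b01f9 (prover) · by planner
why it might fail: Granting H1, no backward-DSS ⇒ finite-energy transfer is known: without hyperbolicity the monodromy may carry unstable spectrum accumulating at the unit circle (on decaying-function spaces νΔ−½y·∇ has half-plane spectrum, GW2002 App. A), and P_σ/Biot–Savart are undefined on L²(e^{−|y|²/4ν}).
sources: JiaSverak2014, JiaSverak2015, BradshawTsai2017CPDE, ChaeWolf2017, ChaeWolf2017RemovingDSS, Tsai2018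
[crux] B, TRUNCATION BRIDGE, strong form (card dss-far-field-slaving CLAIM with (H2) suppressed) —
rev-6 RESTATEMENT = the rev-1 statement with the hypothesis
¬Literature.Analysis.FluidPDE.TypeIDSSLiouvilleConjecture UNFOLDED one level (Iff.rfl; cone repair:
no @[conjecture]-tagged constant in the route cone, and the transitional Literature duplicate of
Tsai's conjecture can now be deleted as its docstring asks): if for some λ (vacuous unless λ>1) and
rotation R ∈ O(3) there is a nontrivial ancient mild solution u_* on ℝ³×(−∞,0), (rotated) λ-DSS,
with Type-I bound |u_*| ≤ C₀/(|x|+√−t) — i.e. the hypothesis is verbatim this route's crux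
BlowupTypeIDssProfile / route Blowup #5 (stmt-0155) — then some rapidly decaying divergence-free
datum has a Leray–Hopf classical solution with finite maximal lifespan (IsMaximalSmoothSolution ∧
IsLerayHopfOn ∧ HasRapidSpatialDecay (u 0); any ν>0 by scaling) = X5a of route Blowup verbatim.
Construction (unchanged): backward similarity variables y = x/√(T−t), s = −log(T−t), U = √(T−t)u;
u_* ↦ s-periodic orbit U_* of ∂_sU = 𝓛U − U·∇U − ∇P, 𝓛 = νΔ − ½y·∇ − ½ (self-adjoint, compact
resolvent, spectrum {−½−k/2} on L²(γ), γ = e^{−|y|²/4ν}); KEY ESTIMATE |⟨ -/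
@[route_item "route-NavierStokesRegularity-DssFarFieldSlaving", crux]
def DssTruncationBridge : Prop :=
  ¬ (∀ c : ℝ, Literature.Analysis.FluidPDE.TypeIDSSLiouville c ∧ ∀ R : EuclideanSpace ℝ (Fin 3) ≃ₗᵢ[ℝ] EuclideanSpace ℝ (Fin 3), Literature.Analysis.FluidPDE.RotatedTypeIDSSLiouville c R) → ∃ ν : ℝ, 0 < ν ∧ ∃ T : ℝ, 0 < T ∧ ∃ (u : ℝ → EuclideanSpace ℝ (Fin 3) → EuclideanSpace ℝ (Fin 3)) (p : ℝ → EuclideanSpace ℝ (Fin 3) → ℝ), Literature.Analysis.FluidPDE.IsMaximalSmoothSolution ν 0 u p T ∧ Literature.Analysis.FluidPDE.IsLerayHopfOn T ν 0 (u 0) u ∧ Literature.Analysis.FluidPDE.HasRapidSpatialDecay (u 0)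

-- `DssTruncationBridge` holds: proved by `Summit.NavierStokesRegularity.NavierStokesRegularity.Theorems.dssTruncationBridge_proof` @ f18bb75b01f9 (its module imports this route file, so no `_holds` link can be stated here).

/-- item stmt-NavierStokesRegularity-0903 · crux · rank 3 · open · by planner
why it might fail: (H2) may be vacuous (rotation modes neutral; far-field essential spectrum), and even for a hyperbolic orbit U·∇U is not C¹ on L²(γ): the stable manifold needs the unproved mixed L²(γ)/L^∞_{1+|y|} decoupling (B2) against nonlocal pressure — the heat template arXiv:1605.07337 is local, unconstrained.
sources: JiaSverak2014, JiaSverak2015, BradshawTsai2017CPDE, Tsai2018, ChaeWolf2017, arXiv:2607.09619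
[crux] (rank 3; informal until the notion `IsHyperbolicTypeIDSSOrbit` is defined — definition
request filed) HYPERBOLIC BRIDGE = the card dss-far-field-slaving's CLAIM in its honest conditional
form: (H1) a nontrivial ancient mild solution u_* on ℝ³×(−∞,0), (rotated) λ-DSS with the Type-I
bound |u_*| ≤ C₀/(|x|+√−t), exists AND (H2) its s-periodic orbit U_* in backward similarity
variables (y = x/√(T−t), s = −log(T−t), U = √(T−t)u; ∂_sU = 𝓛U − U·∇U − ∇P, 𝓛 = νΔ − ½y·∇ − ½) is
HYPERBOLIC: the monodromy operator of the linearisation A(s)w = 𝓛w − P_σ(U_*·∇w + w·∇U_*) on the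
Gaussian-weighted divergence-free space X = L²_σ(e^{−|y|²/4ν}) (vorticity formulation) has finitely
many Floquet multipliers outside the closed unit disc, the multipliers on the unit circle are
exactly the symmetry modes (orbit tangent, rotations), and the rest of the spectrum lies strictly
inside ⇒ X5a: ∃ ν>0, T>0, (u,p) with IsMaximalSmoothSolution ν 0 u p T ∧ IsLerayHopfOn T ν 0 (u 0) u
∧ HasRapidSpatialDecay (u 0) (and IsTypeIBlowup u T). Intended signature once the notion lands: `(∃
c R u, Literature.Analysis.FluidPDE.IsHyperbolicTypeIDSSOrbit c R u) → <X5a shape of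
DssTruncationBridge's conclusion>`. Proof arc -/
@[route_item "route-NavierStokesRegularity-DssFarFieldSlaving"]
def HyperbolicDssBridge : Prop :=
  (∃ (c : ℝ) (R : EuclideanSpace ℝ (Fin 3) ≃ₗᵢ[ℝ] EuclideanSpace ℝ (Fin 3)) (u : ℝ → EuclideanSpace ℝ (Fin 3) → EuclideanSpace ℝ (Fin 3)), Literature.Analysis.FluidPDE.IsHyperbolicTypeIDSSOrbit c R u) → ∃ ν : ℝ, 0 < ν ∧ ∃ T : ℝ, 0 < T ∧ ∃ (u : ℝ → EuclideanSpace ℝ (Fin 3) → EuclideanSpace ℝ (Fin 3)) (p : ℝ → EuclideanSpace ℝ (Fin 3) → ℝ), Literature.Analysis.FluidPDE.IsMaximalSmoothSolution ν 0 u p T ∧ Literature.Analysis.FluidPDE.IsLerayHopfOn T ν 0 (u 0) u ∧ Literature.Analysis.FluidPDE.HasRapidSpatialDecay (u 0)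

/-- item stmt-NavierStokesRegularity-0910 · crux · rank 4 · open · by planner
why it might fail: As stated on L²(e^{−|y|²/4ν}) (growing fields allowed) w = BS(ω) and curl(w×Ω_*) are undefined, while on decaying-vorticity spaces νΔ−½y·∇ loses compact resolvent (half-plane spectrum, GW2002 App. A); a space with BOTH discrete Floquet spectrum and bounded Biot–Savart coupling may not exist.
sources: JiaSverak2015, doi:10.1007/s00220-004-1254-9, arXiv:math/0102197, BradshawTsai2017CPDE, ChaeWolf2017, arXiv:2607.09619
[crux] (rank 4; informal until the linearised similarity-variable operator is available as a
Literature notion — see definition request `IsHyperbolicTypeIDSSOrbit`, which packages it) GAUSSIAN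
FLOQUET THEORY = item (B1) of card dss-far-field-slaving, the cheapest decisive test of the line:
for every ancient mild solution u_* on ℝ³×(−∞,0) that is (rotated) λ-DSS with Type-I bound |u_*| ≤
C₀/(|x|+√−t) (smooth for t<0 by KNSS §4), the linearisation of the rescaled flow about its
s-periodic orbit U_* — in VORTICITY form, Ω = curl U, ∂_sω = (νΔ − ½y·∇ − 1)ω + curl(U_* × ω + w ×
Ω_*), w = Biot–Savart(ω) (the Leray projection P_σ is NOT bounded on L²(e^{−|y|²/4ν}) verbatim, so
the velocity form is avoided; Gallay–Wayne CMP 255 (2005) weighted framework) — generates a strongly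
continuous evolution family on the Gaussian-weighted space L²(e^{−|y|²/4ν}dy) whose one-period
(monodromy) operator is COMPACT; consequently the Floquet spectrum is discrete with 0 as only
accumulation point and (H2) of HyperbolicDssBridge is a finite-dimensional condition. Enabling
estimates to prove: (i) 𝓛_ω = νΔ − ½y·∇ − 1 is self-adjoint on L²(γ) with compact resolvent,
spectrum {−1 − k/2}; (ii) the stretching/tr -/
@[route_item "route-NavierStokesRegularity-DssFarFieldSlaving"]
def GaussianFloquetTheory : Prop :=
  ∀ (c : ℝ) (R : EuclideanSpace ℝ (Fin 3) ≃ₗᵢ[ℝ] EuclideanSpace ℝ (Fin 3)) (u : ℝ → EuclideanSpace ℝ (Fin 3) → EuclideanSpace ℝ (Fin 3)), Literature.Analysis.FluidPDE.IsTypeIDSSProfile c R u → Literature.Analysis.FluidPDE.HasCompactLinearisedMonodromy Literature.Analysis.FluidPDE.gaussianWeight c R u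

-- earlier BlowupTypeIDssProfile (stmt-NavierStokesRegularity-14193, replaced 2026-08-16T04:18:08Z -> stmt-NavierStokesRegularity-0155): retired by None — Summit.NavierStokesRegularity.NavierStokesRegularity.Theses.Blowup.BlowupTypeIDssProfile
/-- item stmt-NavierStokesRegularity-0155 · crux · rank 5 · open · by planner
why it might fail: Tsai's conjecture may simply hold: λ-continuous profiles vanish (NecasRuzickaSverak1996, Tsai1998); λ∈(1,λ_*(C₀)) removed under exactly this Type-I bound, small C₀ trivial (ChaeWolf2017RemovingDSS Thm 1.3, Rmk 1.4); axisymmetric Type I regular (SereginSverak2009).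
sources: Tsai2018, arXiv:1610.09464, ChaeWolf2017RemovingDSS, NecasRuzickaSverak1996, Tsai1998, SereginSverak2009
Negation of the in-tree wall TypeIDSSLiouvilleConjecture (Tsai GSM 192 Conj. 8.8–8.9): for some λ>1
(and rotation R) there is a nontrivial ancient mild solution on ℝ³×(−∞,0), (rotated) λ-DSS, with
Type I bound |u| ≤ C₀/(|x|+√−t). This is the analytic 'profile' half of a DSS blow-up construction;
the other half (truncation to a Schwartz datum keeping the singularity: stable manifold / gluing) is
deliberately not decomposed. Forward DSS solutions exist for every λ
(Literature.Analysis.FluidPDE.chae_wolf_dss_existence, Chae–Wolf 2017); backward self-similar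
(λ-continuous) profiles are excluded in L³/L^q and under local energy bounds (necas_ruzicka_sverak,
tsai_selfsimilar*). [sources: ChaeWolf2017, arXiv:1610.09464, KNSS2009, AlbrittonBarker2019] -/
@[route_item "route-NavierStokesRegularity-DssFarFieldSlaving", crux]
def BlowupTypeIDssProfile : Prop :=
  ¬ (∀ c : ℝ, Literature.Analysis.FluidPDE.TypeIDSSLiouville c ∧ ∀ R : EuclideanSpace ℝ (Fin 3) ≃ₗᵢ[ℝ] EuclideanSpace ℝ (Fin 3), Literature.Analysis.FluidPDE.RotatedTypeIDSSLiouville c R)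

-- earlier DssTruncationBridgeTypeI (stmt-NavierStokesRegularity-0902, replaced 2026-08-16T03:28:35Z -> stmt-NavierStokesRegularity-14478): retired by None — ¬ Literature.Analysis.FluidPDE.TypeIDSSLiouvilleConjecture → ∃ ν : ℝ, 0 < ν ∧ ∃ T : ℝ, 0 < T ∧ ∃ (u : ℝ → EuclideanSpace ℝ (Fin 3) → EuclideanSpace ℝ (Fin 3)) (p : ℝ → EuclideanSpace ℝ (Fin 3) → ℝ), Literature.Analysis.FluidPDE.IsMaximalSmoothSo
/-- item stmt-NavierStokesRegularity-14478 · crux · rank 9 · closed · proved by Summit.NavierStokesRegularity.NavierStokesRegularity.Theorems.dssTruncationBridgeTypeI_proof (prover) · by planner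
why it might fail: Even granting a hyperbolic orbit, the tuned solution is Type-I only if the far-field/core decoupling closes in L^∞_{1+|y|} uniformly in s; a log-loss there gives blow-up without the rate (then only DssTruncationBridge survives).
sources: AlbrittonBarker2019, KNSS2009, JiaSverak2015, arXiv:1605.07337
[support] B with the RATE in the conclusion (what the stable-manifold construction actually yields)
— rev-6 RESTATEMENT with ¬TypeIDSSLiouvilleConjecture unfolded one level (Iff.rfl; cone repair),
otherwise verbatim: under the failure of Tsai's Type-I (rotated) λ-DSS Liouville conjecture there is
a maximal finite-energy classical solution from a rapidly decaying datum that moreover blows up at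
Type-I rate (IsTypeIBlowup u T). Implies DssTruncationBridge by projection (checked, Sketch.lean rc
0); with H1 it exhibits a Type-I singular point, hence (AlbrittonBarker2019 Thm 1.1 / KNSS2009)
bears on route TypeILiouville. [deps: DssTruncationBridge] [difficulty: XL] -/
@[route_item "route-NavierStokesRegularity-DssFarFieldSlaving"]
def DssTruncationBridgeTypeI : Prop :=
  ¬ (∀ c : ℝ, Literature.Analysis.FluidPDE.TypeIDSSLiouville c ∧ ∀ R : EuclideanSpace ℝ (Fin 3) ≃ₗᵢ[ℝ] EuclideanSpace ℝ (Fin 3), Literature.Analysis.FluidPDE.RotatedTypeIDSSLiouville c R) → ∃ ν : ℝ, 0 < ν ∧ ∃ T : ℝ, 0 < T ∧ ∃ (u : ℝ → EuclideanSpace ℝ (Fin 3) → EuclideanSpace ℝ (Fin 3)) (p : ℝ → EuclideanSpace ℝ (Fin 3) → ℝ), Literature.Analysis.FluidPDE.IsMaximalSmoothSolution ν 0 u p T ∧ Literature.Analysis.FluidPDE.IsLerayHopfOn T ν 0 (u 0) u ∧ Literature.Analysis.FluidPDE.HasRapidSpatialDecay (u 0) ∧ Literature.Analysis.FluidPDE.IsTypeIBlowup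 u T

-- `DssTruncationBridgeTypeI` holds: proved by `Summit.NavierStokesRegularity.NavierStokesRegularity.Theorems.dssTruncationBridgeTypeI_proof` (its module imports this route file, so no `_holds` link can be stated here).

-- earlier Assembly (stmt-NavierStokesRegularity-0900, replaced 2026-08-16T03:28:35Z -> stmt-NavierStokesRegularity-14480): retired by None — (¬ Literature.Analysis.FluidPDE.TypeIDSSLiouvilleConjecture → ∃ ν : ℝ, 0 < ν ∧ ∃ T : ℝ, 0 < T ∧ ∃ (u : ℝ → EuclideanSpace ℝ (Fin 3) → EuclideanSpace ℝ (Fin 3)) (p : ℝ → EuclideanSpace ℝ (Fin 3) → ℝ), Literature.Analysis.FluidPDE.IsMaximalSmoothSolution ν 0 u p 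
/-- item stmt-NavierStokesRegularity-14480 · support · rank 1 · closed · proved by Summit.NavierStokesRegularity.NavierStokesRegularity.Theorems.DssFarFieldSlavingAssembly_proof @ d93fbddd0f50 (prover) · by planner
why it might fail: auto-crux — conjecture-grade statement (statement references the registered conjecture Literature.Analysis.FluidPDE.TypeIDSSLiouvilleConjecture); it is open, so it may simply be false
sources: Fefferman2000
[assembly] DssTruncationBridge → BlowupTypeIDssProfile (H1, unfolded) → ClayUniqueness (X5b,
stmt-0153) → ¬NavierStokesRegularity — rev-6 RESTATEMENT with ¬TypeIDSSLiouvilleConjecture unfolded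
one level (Iff.rfl; cone repair), otherwise verbatim. PROVED as a term in the planner's Sketch.lean
(rc 0, axioms propext/Classical.choice/Quot.sound) by the same pure-logic argument as the deciding
theorem `closes` (Clay (A) on the datum u 0, X5b gluing on [0,T), restriction to [0,T+1) vs
maximality); a prover copies it into Theorems/DssFarFieldSlavingAssembly.lean. [difficulty:
provable-now] -/
@[route_item "route-NavierStokesRegularity-DssFarFieldSlaving"]
def Assembly : Prop :=
  (¬ (∀ c : ℝ, Literature.Analysis.FluidPDE.TypeIDSSLiouville c ∧ ∀ R : EuclideanSpace ℝ (Fin 3) ≃ₗᵢ[ℝ] EuclideanSpace ℝ (Fin 3), Literature.Analysis.FluidPDE.RotatedTypeIDSSLiouville c R) → ∃ ν : ℝ, 0 < ν ∧ ∃ T : ℝ, 0 < T ∧ ∃ (u : ℝ → EuclideanSpace ℝ (Fin 3) → EuclideanSpace ℝ (Fin 3)) (p : ℝ → EuclideanSpace ℝ (Fin 3) → ℝ), Literature.Analysis.FluidPDE.IsMaximalSmoothSolution ν 0 u p T ∧ Literature.Analysis.FluidPDE.IsLerayHopfOn T ν 0 (u 0) u ∧ Literature.Analysis.FluidPDE.HasRapidSpatialDecay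 (u 0)) → ¬ (∀ c : ℝ, Literature.Analysis.FluidPDE.TypeIDSSLiouville c ∧ ∀ R : EuclideanSpace ℝ (Fin 3) ≃ₗᵢ[ℝ] EuclideanSpace ℝ (Fin 3), Literature.Analysis.FluidPDE.RotatedTypeIDSSLiouville c R) → (∀ ν : ℝ, 0 < ν → ∀ (u₀ : EuclideanSpace ℝ (Fin 3) → EuclideanSpace ℝ (Fin 3)), Literature.Analysis.FluidPDE.HasRapidSpatialDecay u₀ → ∀ (u v : ℝ → EuclideanSpace ℝ (Fin 3) → EuclideanSpace ℝ (Fin 3)) (p q : ℝ → EuclideanSpace ℝ (Fin 3) → ℝ) (T : ℝ), 0 < T → Literature.Analysis.FluidPDE.IsSmoothOnHalfSpace u → Literature.Analysis.FluidPDE.IsSmoothOnHalfSpace p → Literature.Analysis.FluidPDE.IsNavierStokesSolution ν 0 u₀ u p → Literature.Analysis.FluidPDE.HasBoundedEnergy u → Literature.Analysis.FluidPDE.IsClassicalNSSolutionOn (Set.Ico 0 T) ν 0 v q → Literature.Analysis.FluidPDE.IsLerayHopfOn T ν 0 u₀ v → v 0 = u₀ → ∀ t ∈ Set.Ico 0 T,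 u t = v t) → ¬ NavierStokesRegularity

-- `Assembly` holds: proved by `Summit.NavierStokesRegularity.NavierStokesRegularity.Theorems.DssFarFieldSlavingAssembly_proof` @ d93fbddd0f50 (its module imports this route file, so no `_holds` link can be stated here).

/-- item stmt-NavierStokesRegularity-0153 · support · rank 9 · closed · proved by Summit.NavierStokesRegularity.NavierStokesRegularity.Theorems.adiabaticEddy_clayUniqueness_proof @ bd26efe366a2 (prover) · by planner
sources: Tao2011, Fefferman2000
Fefferman's class (A) = jointly C^∞ on ℝ³×[0,∞) + sup_t ∫|u|² < ∞; no energy inequality, no decay of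
∇u, no integrability in LPS scales is assumed. Claim: such (u,p) coincides on [0,T) with any
Leray–Hopf classical solution v from the same rapidly decaying datum. Expected route: smoothness +
bounded energy ⇒ u is a distributional solution with locally finite dissipation?? (NOT automatic:
∫∫|∇u|² may be infinite) — this is exactly the delicate point; alternatives: Liouville-type control
of the pressure (p harmonic part must be affine ⇒ excluded by bounded energy), then local energy
inequality, then weak–strong uniqueness (Prodi 1959, Serrin 1963) against v which is in every LPS
class on compacts of [0,T). [sources: Prodi1959, Serrin1963, Fefferman2000, LemarieRieusset2002,
RobinsonRodrigoSadowski2016] -/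
@[route_item "route-NavierStokesRegularity-DssFarFieldSlaving"]
def ClayUniqueness : Prop :=
  ∀ ν : ℝ, 0 < ν → ∀ (u₀ : EuclideanSpace ℝ (Fin 3) → EuclideanSpace ℝ (Fin 3)), Literature.Analysis.FluidPDE.HasRapidSpatialDecay u₀ → ∀ (u v : ℝ → EuclideanSpace ℝ (Fin 3) → EuclideanSpace ℝ (Fin 3)) (p q : ℝ → EuclideanSpace ℝ (Fin 3) → ℝ) (T : ℝ), 0 < T → Literature.Analysis.FluidPDE.IsSmoothOnHalfSpace u → Literature.Analysis.FluidPDE.IsSmoothOnHalfSpace p → Literature.Analysis.FluidPDE.IsNavierStokesSolution ν 0 u₀ u p → Literature.Analysis.FluidPDE.HasBoundedEnergy u → Literature.Analysis.FluidPDE.IsClassicalNSSolutionOn (Set.Ico 0 T) ν 0 v q → Literature.Analysis.FluidPDE.IsLerayHopfOn T ν 0 u₀ v → v 0 = u₀ → ∀ t ∈ Set.Ico 0 T, u t = v t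

/-- `ClayUniqueness` holds: proved by `Summit.NavierStokesRegularity.NavierStokesRegularity.Theorems.adiabaticEddy_clayUniqueness_proof` @ bd26efe366a2. -/
theorem ClayUniqueness_holds : ClayUniqueness := _root_.Summit.NavierStokesRegularity.NavierStokesRegularity.Theorems.adiabaticEddy_clayUniqueness_proof

/-- item stmt-NavierStokesRegularity-14481 · support · rank 9 · closed · proved by Summit.NavierStokesRegularity.NavierStokesRegularity.Theorems.thesisOfCruxes_proof @ 3d2f2487dd1f (prover) · by planner
[support] glue to the target (answers route.target-unreachable): the two cruxes B =
DssTruncationBridge and H1 = BlowupTypeIDssProfile give X = Thesis = B ∧ H1 — one line, `fun hB hP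
=> ⟨hB, hP⟩` (the second component by definitional unfolding of Blowup.BlowupTypeIDssProfile;
checked in Sketch.lean rc 0). [deps: DssTruncationBridge, BlowupTypeIDssProfile, Thesis]
[difficulty: provable-now] -/
@[route_item "route-NavierStokesRegularity-DssFarFieldSlaving"]
def ThesisOfCruxes : Prop :=
  DssTruncationBridge → BlowupTypeIDssProfile → Thesis

-- `ThesisOfCruxes` holds: proved by `Summit.NavierStokesRegularity.NavierStokesRegularity.Theorems.thesisOfCruxes_proof` @ 3d2f2487dd1f (its module imports this route file, so no `_holds` link can be stated here).

/-! D-0027 §2.1 — DECIDING THEOREM (planner-authored via `route open/edit --closes-file`; by planner-rchoice-NavierStokesRegularity-DssFarF-ae553558-g3-0 2026-08-16T04:18:08Z):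
its hypotheses are this route's items and its conclusion the sub-problem Statement (glue_lint), and it elaborates with this file. -/

/-- DECIDING THEOREM (D-0027 §2.1), CRUX-ONLY form, of the conditional negative-side bridge
`DssFarFieldSlaving`: its hypotheses are exactly the route's two load-bearing cruxes —
the truncation bridge `DssTruncationBridge` (B: failure of Tsai's Type-I (rotated) λ-DSS Liouville
conjecture ⇒ a maximal finite-lifespan Leray–Hopf classical solution from a rapidly decaying datum) and
the profile premise `BlowupTypeIDssProfile` (H1 = ¬(Tsai's conjecture) = the SHARED ledger item
stmt-NavierStokesRegularity-0155 = route Blowup's crux #5 `Blowup.BlowupTypeIDssProfile`, the declared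
conditional_on, `Iff.rfl`). Clay-class uniqueness X5b (`ClayUniqueness`, stmt-0153, support) is NO LONGER
a hypothesis: it is a theorem in tree — `¬¬X5b` is the landed refutation
`Theorems.BlowupBlowupClayNonuniqueness_refuted` (Tao 2013 Cor. 11.4 via
`tao_unconditional_uniqueness_velocity_holds`; axioms standard) — and is discharged inside the proof.
Pure logic after that: apply Clay (A) to the datum `u 0` of the blowing-up solution, identify the global
Clay-class solution with it on `[0,T)` by X5b, read the Clay-class solution as a classical solution on
`Ici 0`, restrict to `[0,T+1)` — a smooth extension past `T`, contradicting maximality. -/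
@[closes "route-NavierStokesRegularity-DssFarFieldSlaving"] theorem closes (hB : DssTruncationBridge) (hP : BlowupTypeIDssProfile) :
    ¬ _root_.NavierStokesRegularity := by
  intro hA
  have hU : ClayUniqueness :=
    Classical.not_not.mp
      _root_.Summit.NavierStokesRegularity.NavierStokesRegularity.Theorems.BlowupBlowupClayNonuniqueness_refuted
  obtain ⟨ν, hν, T, hT, u, p, ⟨hcl, hmax⟩, hLH, hdec⟩ := hB hP
  have h0 : (0 : ℝ) ∈ Set.Ico 0 T := ⟨le_rfl, hT⟩
  obtain ⟨u', p', hu', hp', hns, hbe⟩ :=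
    hA ν hν (u 0) (hcl.contDiff_velocity h0) (hcl.divFree 0 h0) hdec
  have heq : ∀ t ∈ Set.Ico 0 T, u' t = u t :=
    hU ν hν (u 0) hdec u' u p' p T hT hu' hp' hns hbe hcl hLH rfl
  have hcl' : Literature.Analysis.FluidPDE.IsClassicalNSSolutionOn (Set.Ici 0) ν 0 u' p' :=
    ⟨hu', hp', fun t ht x => hns.momentum t ht x, fun t ht => hns.divFree t ht⟩
  refine hmax ⟨T + 1, by linarith, u', p', ?_, heq⟩
  exact hcl'.mono (fun t ht => ht.1) (uniqueDiffOn_Ico 0 (T + 1))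

end Summit.NavierStokesRegularity.NavierStokesRegularity.Theses.DssFarFieldSlaving
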